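/-
Copyright (c) 2026 the pub-hodgecm-mathlib formalisation cell (harness21).  Prover seat hodgecm-mathlib-LH4-p10 (g9), Track B ∕ R90-TF, h413 = `stmt-HodgeConjecture-24833`,
R90-TF section S8 «ContSpec-n½» (S8 dealer R90-CS-plan (g4) S8-R254 (1) «(hKreg) FILE 2»): the CLASS BRIDGE and the `K_∞`-FINITENESS closing ★ p865022 `admissible_rightAverage` into the
datum-level letter (hKreg) of ★ p865108 `hW1_of_regular (hFIN) (hKwild) (hKreg)` — «the `K_∞`-type cut `P_τ f` of the class of a REGULAR τ-level datum is a τ-admissible generator».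
-/
import Summits.HodgeConjecture.HodgeConjecture.Theorems.R90S8ResGMidAtomGenKTypeProjectionU3      -- ★ p865022 (this seat): `admissible_rightAverage` ((hstab) at function level); brings ★ D1∕τ-DEFS, ★ `midPoleLetter_apply_quotientSubgroup_mul`
import Summits.HodgeConjecture.HodgeConjecture.Theorems.R90S8ResGMidBlockLeTauOfRegularU3           -- ★ p865108 (CS-p03): the (hKreg) bytes, `K_∞ := arch ⊓ U(1)`, ★ `adelicVal_archToAdelic_inclusion_mem_standardMaximalCompactGL`; brings ★ `Schur.charProj`, ★ `compactSpace_arch_inf_unitaryOne`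
import Summits.HodgeConjecture.HodgeConjecture.Theorems.K2E1PseudoEisensteinKTypeAverageU2          -- ★ (K2E1): `coeFn_integral_smul_rightRegular_ae_eq` (the `L²` ↔ pointwise bridge for weighted `K`-averages), `integral_mul_comp_congr_ae`
import Literature.RepresentationTheory.CompactGroups.CharacterMultiplicity                         -- ★ `Schur.character_inv` (`χ(g⁻¹) = conj χ(g)`, unitary), ★ `Schur.character_eq_sum_inner`, ★ `Schur.continuous_inner_apply`
import HarnessLib

/-!
# S8 (hKreg) FILE 2 — `R90S8ResGMidAtomGenKTypeProjectionClassU3`: THE `K_∞`-TYPE CUT OF THE CLASS OF A REGULAR τ-LEVEL DATUM IS A τ-ADMISSIBLE GENERATOR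

Track B ∕ R90-TF, crux h413 = `stmt-HodgeConjecture-24833`, route of record `HCCMUnconditional`; cell `hodgecm-mathlib`, R90-TF section S8 «ContSpec-n½ ∕ ResidualSpectrum», the hW1 road
(★ p865108 `hW1_of_regular (hFIN) (hKwild) (hKreg)`, letter `hW1` of (R)′ :337 ∕ (M) :299 ∕ (V♭) :406).  THEOREMS ONLY (no `def`, no `instance`, no `notation`, no named-fact hypothesis,
no `sorry`; default heartbeats); lane `--supports stmt-HodgeConjecture-24833 --as helper` (count-neutral).  CLOSES NO SOCKET.

THE MATHEMATICS ([BrockerTomDieck1985] II (4.9)–(4.10), III (5.10); [MoeglinWaldspurger1995] I.2.17, II.1, IV.1.9–IV.1.11, V.3.13; [BorelJacquet1979] §1.3, §4.1, §4.6).  Let `K_∞ =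
U(J₃)(L⁺⊗ℝ) ∩ U(1⊗1)` act on `L²` through `ρ = R ∘ ι_∞`, let `(φ, Ec, Sp, Fp)` be a REGULAR D1 datum at the τ-level `ι_f(U₀)` with class `f =ᵐ x ↦ Fp((out x)⁻¹)(3∕2)`, and let `τ` be an
irreducible unitary finite-dimensional representation of `K_∞` with character `χ_τ`.  (i) CLASS BRIDGE: `P_τ f = d_τ•∫ conj χ_τ(k)•R(ι k) f dμ_K` has the representative `x ↦ ∫ d_τ conj χ_τ(k)·
f(ι(k)⁻¹•x) dμ_K` (★ `coeFn_integral_smul_rightRegular_ae_eq`), and `f(ι(k)⁻¹•x) = Fp((out x)⁻¹·ι k)(3∕2)` a.e. JOINTLY (★ `integral_mul_comp_congr_ae` + left-`G(F)`-invariance of the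
residue function ★ `midPoleLetter_apply_quotientSubgroup_mul` via ★ `quotFun_rightTranslation`), so `P_τ f =ᵐ x ↦ Fp′((out x)⁻¹)(3∕2)` for the AVERAGED pole letter `Fp′` of ★
`admissible_rightAverage` with weight `c = d_τ·conj χ_τ`.  (ii) `K_∞`-FINITENESS: `r(ι a)(P_c φ) = P_{c(a⁻¹·)} φ` (left invariance of `μ_K`), and the left translates of `conj χ_τ` span a
finite-dimensional space of matrix coefficients (`conj χ_τ(a⁻¹k) = χ_τ(k⁻¹a) = Σ_{i,j} ⟪τ k e_i, e_j⟫·⟪e_j, τ a e_i⟫`, ★ `character_inv`, ★ `character_eq_sum_inner`, Parseval), so the span of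
the `K_∞`-translates of `P_c φ` is finite-dimensional — `IsArchFinite` — provided every element of `ι(K_∞) = archMaximalCompact` is an `ι_∞(a)`, `a ∈ K_∞` (the structural letter `hsurj`,
§0).  (iii) With ★ `admissible_rightAverage` (pair law at the τ-level via ★ `commute_archToAdelic_finAdelicToAdelic`, height invariance via ★
`adelicVal_archToAdelic_inclusion_mem_standardMaximalCompactGL`, T's `hE4`∕`hEbd`) the averaged datum `(P_c φ, P_c ∘ Ec, Sp, Fp′)` is admissible, hence `P_τ f ∈ resGMidAtomGenτ ξ μω U₀`:
the letter (hKreg) of ★ p865108 BYTE FOR BYTE; the structural identity `archMaximalCompact = ι_∞(K_∞)` is §0.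
* §0 `exists_inclusion_eq_of_mem_archMaximalCompact` (`archMaximalCompact = ι_∞(U(J₃)(L⁺⊗ℝ) ∩ U(1⊗1))`).
* §1 `rightAverage_weight_sum` (linearity in the weight), `rightTranslation_rightAverage_eq` (`r(ι a) P_c φ = P_{c(a⁻¹·)} φ`), **`isArchFinite_rightAverage`** (from a finite matrix-coefficient
  expansion of the translated weights + `hsurj`), **`exists_matrixCoeff_expansion_conj_character`** (the expansion for `c = d_τ·conj χ_τ`).
* §2 **`coeFn_charProj_rightRegular_ae_eq`** (the class bridge), **`coeFn_charProj_ae_eq_midPoleLetter_rightAverage`** (at a residue class).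
* §3 **HEAD `hKreg_of_regular (hμω)`** — ★ p865108's binder (hKreg) BYTE FOR BYTE (§0 discharges the structural identity `archMaximalCompact = ι_∞(K_∞)`).
HONEST LABEL: HC_CM is proved only modulo the 7 printed citations (2 remaining named inputs: hLiu418 = `stmt-HodgeConjecture-24832`, h413 = `stmt-HodgeConjecture-24833`) until
rung 0 closes; REL ≠ ★ ≠ BUILT; (hKreg) becomes ★ LETTER-FREE for REGULAR data (only `μω` unitary, the socket's own); hW1 = ★ p865108 ∘ {(hFIN) ★ p865069 road,
(hKreg) THIS, (hKwild) L}; pays no socket; count-neutral.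

## References
* [BrockerTomDieck1985] T. Bröcker, T. tom Dieck, *Representations of Compact Lie Groups*, GTM 98 (1985), II (4.9)–(4.10), III Thm. (5.10).
* [MoeglinWaldspurger1995] C. Mœglin, J.-L. Waldspurger, *Spectral Decomposition and Eisenstein Series* (1995), I.2.17, II.1, IV.1.9–IV.1.11, V.3.13.
* [BorelJacquet1979] A. Borel, H. Jacquet, *Automorphic forms and automorphic representations*, Proc. Sympos. Pure Math. 33.1 (1979), §1.3, §4.1, §4.6.
-/

set_option autoImplicit false
set_option linter.dupNamespace false  -- the mandated namespace `…HodgeConjecture.HodgeConjecture.R90.S8` (LEAD #1 L1) repeats the summit's segment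

noncomputable section

open MeasureTheory Measure Set Filter Topology NumberField NumberField.mixedEmbedding ContRepresentation
open Literature.NumberTheory Literature.NumberTheory.Automorphic Literature.NumberTheory.Automorphic.UnitaryGroup Literature.NumberTheory.GaloisRepresentations AdelicGroupData
open Literature.NumberTheory.Automorphic.Arthur2013.Leaves.TECR Literature.NumberTheory.Rogawski1990
open Literature.RepresentationTheory.CompactGroups
open Summit.HodgeConjecture.HodgeConjecture.Cruxes.H413.K2E1BorelEisensteinU
open Summit.HodgeConjecture.HodgeConjecture.Cruxes.H413.K2E1CharacterEisensteinU3PairDefs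
open Summit.HodgeConjecture.HodgeConjecture.Cruxes.H413.K2E1ChiSectionSpaceU3PairDefs
open Summit.HodgeConjecture.HodgeConjecture.Cruxes.H413.K2E1MaximalLevelHeckePureTensorBridgeCMTwo (adelicVal_archToAdelic_inclusion_mem_standardMaximalCompactGL)
open Summit.HodgeConjecture.HodgeConjecture.Cruxes.H413.K2E1PseudoEisensteinKTypeAverageU2 (coeFn_integral_smul_rightRegular_ae_eq integral_mul_comp_congr_ae)
open scoped ENNReal NNReal InnerProductSpace ComplexConjugate

namespace Summit.HodgeConjecture.HodgeConjecture.R90.S8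

/-! ## §0 The structural identity `archMaximalCompact = ι_∞(K_∞)`, `K_∞ = U(J₃)(L⁺⊗ℝ) ∩ U(1⊗1)` -/

/-- **EVERY ELEMENT OF `ι(K_∞) = archMaximalCompact` IS `ι_∞(a)` WITH `a ∈ K_∞ = U(J₃)(L⁺⊗ℝ) ∩ U(1⊗1)`** (the converse of ★ `adelicVal_archToAdelic_inclusion_mem_standardMaximalCompactGL`):
`k = ι_∞(a)` with `a ∈ U(J₃)(L⁺⊗ℝ)` (★ `mem_archMaximalCompact_iff`), `(k)_∞ = a ∈ K_∞^{GL}` (★ `toMixed_mem_Kinf_of_mem_standardMaximalCompactGL`, ★ `GLn.toMixed_ofInfinite`), and `K_∞^{GL} =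
U(1⊗1)` at a CM pair (no real place; ★ `mem_Kinf_iff`, ★ `mem_arch_iff_forall`, ★ `mem_archLocal_iff_conjTranspose`). [cite: BorelJacquet1979, §1.1, §4.1] -/
theorem exists_inclusion_eq_of_mem_archMaximalCompact (L : Type) [Field L] [NumberField L] [IsCMField L] (k₀ : ↥(archMaximalCompact L)) :
    ∃ a : ↥(UnitaryGroup.arch (↥(maximalRealSubfield L)) L (IsCMField.complexConj L) 3 ((StdForm.antidiagonal 3).over L) ⊓ unitaryGroupOfForm (conjMixed (↥(maximalRealSubfield L)) L (IsCMField.complexConj L)) 1),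
      ((archToAdelic (↥(maximalRealSubfield L)) L (IsCMField.complexConj L) 3 ((StdForm.antidiagonal 3).over L)).comp
        (Subgroup.inclusion (inf_le_left : (UnitaryGroup.arch (↥(maximalRealSubfield L)) L (IsCMField.complexConj L) 3 ((StdForm.antidiagonal 3).over L) ⊓ unitaryGroupOfForm (conjMixed (↥(maximalRealSubfield L)) L (IsCMField.complexConj L)) 1) ≤
          UnitaryGroup.arch (↥(maximalRealSubfield L)) L (IsCMField.complexConj L) 3 ((StdForm.antidiagonal 3).over L)))) a = (k₀ : (quasiSplit (↥(maximalRealSubfield L)) L (IsCMField.complexConj L) 3).Adelic) := by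
  obtain ⟨hK, a, ha⟩ := (mem_archMaximalCompact_iff L (k₀ : (quasiSplit (↥(maximalRealSubfield L)) L (IsCMField.complexConj L) 3).Adelic)).1 k₀.2
  have hc : IsCMField.complexConj L ≠ 1 := IsCMField.complexConj_ne_one L
  have hfix : ∀ w : InfinitePlace L, IsCMField.complexConj L • w = w := complexConj_smul_infinitePlace L
  haveI := isEmpty_isReal (↥(maximalRealSubfield L)) L (IsCMField.complexConj L) hc hfix
  -- the archimedean component of `k₀` is `a`, and it lies in `K_∞^{GL}`
  have haK : ((a : ↥(UnitaryGroup.arch (↥(maximalRealSubfield L)) L (IsCMField.complexConj L) 3 ((StdForm.antidiagonal 3).over L))) : GL (Fin 3) (mixedSpace L)) ∈ Kinf 3 L := by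
    have h := toMixed_mem_Kinf_of_mem_standardMaximalCompactGL hK
    rwa [← ha, adelicVal_archToAdelic, GLn.toMixed_ofInfinite] at h
  -- hence `a ∈ U(1 ⊗ 1)`
  have ha1 : ((a : ↥(UnitaryGroup.arch (↥(maximalRealSubfield L)) L (IsCMField.complexConj L) 3 ((StdForm.antidiagonal 3).over L))) : GL (Fin 3) (mixedSpace L)) ∈
      unitaryGroupOfForm (conjMixed (↥(maximalRealSubfield L)) L (IsCMField.complexConj L)) 1 := by
    have h1form : archFormOf L 3 (1 : Matrix (Fin 3) (Fin 3) L) = 1 := Matrix.map_one _ (map_zero _) (map_one _)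
    have h' : ((a : ↥(UnitaryGroup.arch (↥(maximalRealSubfield L)) L (IsCMField.complexConj L) 3 ((StdForm.antidiagonal 3).over L))) : GL (Fin 3) (mixedSpace L)) ∈
        UnitaryGroup.arch (↥(maximalRealSubfield L)) L (IsCMField.complexConj L) 3 (1 : Matrix (Fin 3) (Fin 3) L) := by
      rw [mem_arch_iff_forall (↥(maximalRealSubfield L)) L (IsCMField.complexConj L) 3 (1 : Matrix (Fin 3) (Fin 3) L) hc hfix]
      intro w
      have hw := ((mem_Kinf_iff 3 L _).1 haK).2 w
      rw [mem_unitarySubgroupGL_iff, Matrix.star_eq_conjTranspose] at hw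
      rw [mem_archLocal_iff_conjTranspose, Matrix.map_one _ (map_zero _) (map_one _), Matrix.mul_one]
      exact hw
    change _ ∈ unitaryGroupOfForm (conjMixed (↥(maximalRealSubfield L)) L (IsCMField.complexConj L)) (archFormOf L 3 (1 : Matrix (Fin 3) (Fin 3) L)) at h'
    rwa [h1form] at h'
  refine ⟨⟨(a : GL (Fin 3) (mixedSpace L)), Subgroup.mem_inf.2 ⟨a.2, ha1⟩⟩, ?_⟩
  rw [← ha]
  rfl

/-! ## §1 Linearity in the weight, translates of a right average, `K_∞`-finiteness -/

section Finite

variable (L : Type) [Field L] [NumberField L] [IsCMField L]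
  {K : Type*} [TopologicalSpace K] [MeasurableSpace K] [OpensMeasurableSpace K] [CompactSpace K] (μK : Measure K) [IsFiniteMeasure μK]

/-- **Linearity of the right average in the weight**: `∫ (Σ_i a_i·b_i(k))·Φ(x·ι k) = Σ_i a_i·∫ b_i(k)·Φ(x·ι k)` for continuous weights `b_i` and continuous `Φ` (every integrand is
continuous on the compact `K`, hence integrable for the finite `μ_K`). [cite: BorelJacquet1979, §1.3] -/
theorem rightAverage_weight_sum (ι : K → (quasiSplit (↥(maximalRealSubfield L)) L (IsCMField.complexConj L) 3).Adelic) (hι : Continuous ι)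
    {I : Type*} [Fintype I] (b : I → K → ℂ) (hb : ∀ i, Continuous (b i)) (a : I → ℂ)
    {Φ : (quasiSplit (↥(maximalRealSubfield L)) L (IsCMField.complexConj L) 3).Adelic → ℂ} (hΦ : Continuous Φ) (x : (quasiSplit (↥(maximalRealSubfield L)) L (IsCMField.complexConj L) 3).Adelic) :
    (∫ k, (∑ i, a i * b i k) * Φ (x * ι k) ∂μK) = ∑ i, a i * ∫ k, b i k * Φ (x * ι k) ∂μK := by
  have hint : ∀ i, Integrable (fun k => b i k * Φ (x * ι k)) μK := fun i =>
    ((hb i).mul (hΦ.comp (continuous_const.mul hι))).integrable_of_hasCompactSupport (HasCompactSupport.of_compactSpace _)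
  simp_rw [Finset.sum_mul, mul_assoc]
  rw [integral_finsetSum _ fun i _ => (hint i).const_mul (a i)]
  exact Finset.sum_congr rfl fun i _ => integral_const_mul _ _

variable [Group K] [IsTopologicalGroup K] [BorelSpace K] [μK.IsMulLeftInvariant]

omit [OpensMeasurableSpace K] [CompactSpace K] [IsFiniteMeasure μK] in
/-- **Translates of a right average are right averages with translated weight**: `(P_c φ)(x·ι a) = ∫ c(a⁻¹k)·φ(x·ι k) dμ_K` for a monoid homomorphism `ι` and a left-invariant `μ_K`
(substitute `k ↦ a·k`, Mathlib `integral_mul_left_eq_self`). [cite: BorelJacquet1979, §1.3] -/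
theorem rightTranslation_rightAverage_eq (ι : K →* (quasiSplit (↥(maximalRealSubfield L)) L (IsCMField.complexConj L) 3).Adelic) (c : K → ℂ)
    (φ : (quasiSplit (↥(maximalRealSubfield L)) L (IsCMField.complexConj L) 3).Adelic → ℂ) (a : K) (x : (quasiSplit (↥(maximalRealSubfield L)) L (IsCMField.complexConj L) 3).Adelic) :
    (∫ k, c k * φ (x * ι a * ι k) ∂μK) = ∫ k, c (a⁻¹ * k) * φ (x * ι k) ∂μK := by
  rw [← integral_mul_left_eq_self (fun k => c (a⁻¹ * k) * φ (x * ι k)) a]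
  refine integral_congr_ae (Eventually.of_forall fun k => ?_)
  simp only [inv_mul_cancel_left, map_mul, mul_assoc]

omit [OpensMeasurableSpace K] in
/-- **`K_∞`-FINITENESS OF A RIGHT AVERAGE**: if the left translates `k ↦ c(a⁻¹k)` of the weight all lie in the span of finitely many continuous functions `b_i` (a matrix-coefficient
expansion, `hcfin`) and every element of `ι(K_∞) = archMaximalCompact` is an `ι a` (`hsurj`), then the `K_∞`-translates of `P_c φ` span a finite-dimensional space: `IsArchFinite (P_c φ)` —
`r(ι a) P_c φ = P_{c(a⁻¹·)} φ = Σ_i λ_i(a)·P_{b_i} φ`. [cite: BorelJacquet1979, §1.3, §4.1] [cite: BrockerTomDieck1985, III (5.10)] -/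
theorem isArchFinite_rightAverage (ι : K →* (quasiSplit (↥(maximalRealSubfield L)) L (IsCMField.complexConj L) 3).Adelic) (hι : Continuous ι) (c : K → ℂ)
    {I : Type*} [Fintype I] (b : I → K → ℂ) (hb : ∀ i, Continuous (b i))
    (hcfin : ∀ a : K, ∃ coef : I → ℂ, (fun k => c (a⁻¹ * k)) = fun k => ∑ i, coef i * b i k)
    (hsurj : ∀ k₀ : ↥(archMaximalCompact L), ∃ a : K, ι a = (k₀ : (quasiSplit (↥(maximalRealSubfield L)) L (IsCMField.complexConj L) 3).Adelic))
    {φ : (quasiSplit (↥(maximalRealSubfield L)) L (IsCMField.complexConj L) 3).Adelic → ℂ} (hφ : Continuous φ) :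
    IsArchFinite L (fun x => ∫ k, c k * φ (x * ι k) ∂μK) := by
  rw [isArchFinite_iff, archTranslateSpan_def]
  -- the finite-dimensional target: the span of the averages against the `b_i`
  haveI : FiniteDimensional ℂ ↥(Submodule.span ℂ (Set.range fun i : I => fun x : (quasiSplit (↥(maximalRealSubfield L)) L (IsCMField.complexConj L) 3).Adelic => ∫ k, b i k * φ (x * ι k) ∂μK)) :=
    FiniteDimensional.span_of_finite ℂ (Set.finite_range fun i : I => fun x : (quasiSplit (↥(maximalRealSubfield L)) L (IsCMField.complexConj L) 3).Adelic => ∫ k, b i k * φ (x * ι k) ∂μK)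
  refine Submodule.finiteDimensional_of_le
    (S₂ := Submodule.span ℂ (Set.range fun i : I => fun x : (quasiSplit (↥(maximalRealSubfield L)) L (IsCMField.complexConj L) 3).Adelic => ∫ k, b i k * φ (x * ι k) ∂μK)) (Submodule.span_le.2 ?_)
  rintro _ ⟨k₀, rfl⟩
  obtain ⟨a, ha⟩ := hsurj k₀
  obtain ⟨coef, hcoef⟩ := hcfin a
  have hfun : rightTranslation (quasiSplit (↥(maximalRealSubfield L)) L (IsCMField.complexConj L) 3) (k₀ : (quasiSplit (↥(maximalRealSubfield L)) L (IsCMField.complexConj L) 3).Adelic)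
      (fun x => ∫ k, c k * φ (x * ι k) ∂μK) = ∑ i, coef i • fun x => ∫ k, b i k * φ (x * ι k) ∂μK := by
    funext x
    rw [rightTranslation_apply, ← ha, Finset.sum_apply]
    simp only [Pi.smul_apply, smul_eq_mul]
    rw [rightTranslation_rightAverage_eq L μK ι c φ a x, ← rightAverage_weight_sum L μK ι hι b hb coef hφ x]
    refine integral_congr_ae (Eventually.of_forall fun k => ?_)
    show c (a⁻¹ * k) * φ (x * ι k) = (∑ i, coef i * b i k) * φ (x * ι k)
    rw [show c (a⁻¹ * k) = ∑ i, coef i * b i k from congrFun hcoef k]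
  change rightTranslation (quasiSplit (↥(maximalRealSubfield L)) L (IsCMField.complexConj L) 3) (k₀ : (quasiSplit (↥(maximalRealSubfield L)) L (IsCMField.complexConj L) 3).Adelic)
      (fun x => ∫ k, c k * φ (x * ι k) ∂μK) ∈ _
  rw [hfun]
  exact Submodule.sum_mem _ fun i _ => Submodule.smul_mem _ _ (Submodule.subset_span ⟨i, rfl⟩)

omit [TopologicalSpace K] [MeasurableSpace K] [CompactSpace K] [IsTopologicalGroup K] [BorelSpace K] in
/-- **THE MATRIX-COEFFICIENT EXPANSION OF THE TRANSLATED CHARACTER WEIGHT**: for a unitary finite-dimensional `τ` and an orthonormal basis `e`, `d·conj χ_τ(a⁻¹k) = Σ_{(i,j)}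
(d·⟪e_j, τ a e_i⟫)·⟪τ k e_i, e_j⟫` (`conj χ(a⁻¹k) = χ(k⁻¹a)` ★ `character_inv`; `χ = Σ_i ⟪e_i, τ(·) e_i⟫` ★ `character_eq_sum_inner`; unitarity; Parseval `OrthonormalBasis.sum_inner_mul_inner`).
[cite: BrockerTomDieck1985, II (4.9)–(4.10)] -/
theorem exists_matrixCoeff_expansion_conj_character {E : Type*} [NormedAddCommGroup E] [InnerProductSpace ℂ E] [FiniteDimensional ℂ E]
    (τ : ContRepresentation ℂ K E) (hτu : ∀ (g : K) (x y : E), ⟪τ g x, τ g y⟫_ℂ = ⟪x, y⟫_ℂ) (d : ℂ) (a : K) :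
    ∃ coef : Fin (Module.finrank ℂ E) × Fin (Module.finrank ℂ E) → ℂ,
      (fun k => d * conj (Schur.character τ (a⁻¹ * k))) =
        fun k => ∑ p : Fin (Module.finrank ℂ E) × Fin (Module.finrank ℂ E), coef p * ⟪τ k (stdOrthonormalBasis ℂ E p.1), stdOrthonormalBasis ℂ E p.2⟫_ℂ := by
  refine ⟨fun p => d * ⟪stdOrthonormalBasis ℂ E p.2, τ a (stdOrthonormalBasis ℂ E p.1)⟫_ℂ, funext fun k => ?_⟩
  have hinv : conj (Schur.character τ (a⁻¹ * k)) = Schur.character τ (k⁻¹ * a) := by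
    rw [← Schur.character_inv hτu, mul_inv_rev, inv_inv]
  have hcoeff : ∀ i, ⟪stdOrthonormalBasis ℂ E i, τ (k⁻¹ * a) (stdOrthonormalBasis ℂ E i)⟫_ℂ =
      ∑ j, ⟪τ k (stdOrthonormalBasis ℂ E i), stdOrthonormalBasis ℂ E j⟫_ℂ * ⟪stdOrthonormalBasis ℂ E j, τ a (stdOrthonormalBasis ℂ E i)⟫_ℂ := by
    intro i
    have h1 : τ (k⁻¹ * a) (stdOrthonormalBasis ℂ E i) = τ k⁻¹ (τ a (stdOrthonormalBasis ℂ E i)) := by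
      rw [map_mul]; rfl
    have h3 : τ k (τ k⁻¹ (τ a (stdOrthonormalBasis ℂ E i))) = τ a (stdOrthonormalBasis ℂ E i) := by
      rw [show τ k (τ k⁻¹ (τ a (stdOrthonormalBasis ℂ E i))) = τ (k * k⁻¹) (τ a (stdOrthonormalBasis ℂ E i)) by rw [map_mul]; rfl, mul_inv_cancel, map_one]
      rfl
    have h2 : ⟪stdOrthonormalBasis ℂ E i, τ k⁻¹ (τ a (stdOrthonormalBasis ℂ E i))⟫_ℂ = ⟪τ k (stdOrthonormalBasis ℂ E i), τ a (stdOrthonormalBasis ℂ E i)⟫_ℂ := by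
      rw [← hτu k, h3]
    rw [h1, h2, ← (stdOrthonormalBasis ℂ E).sum_inner_mul_inner]
  rw [hinv, Schur.character_eq_sum_inner (stdOrthonormalBasis ℂ E), Finset.mul_sum, Fintype.sum_prod_type]
  refine Finset.sum_congr rfl fun i _ => ?_
  rw [hcoeff i, Finset.mul_sum]
  exact Finset.sum_congr rfl fun j _ => by ring

end Finite

/-! ## §2 The class bridge: the representative of `P_τ f` -/

section Bridge

variable (L : Type) [Field L] [NumberField L] [IsCMField L]
  [MeasurableSpace (quasiSplit (↥(maximalRealSubfield L)) L (IsCMField.complexConj L) 3).Adelic] [BorelSpace (quasiSplit (↥(maximalRealSubfield L)) L (IsCMField.complexConj L) 3).Adelic]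
  (μ : Measure (quasiSplit (↥(maximalRealSubfield L)) L (IsCMField.complexConj L) 3).automorphicQuotient)
  [(quasiSplit (↥(maximalRealSubfield L)) L (IsCMField.complexConj L) 3).IsAutomorphicMeasure μ]
  {K : Type*} [Group K] [TopologicalSpace K] [IsTopologicalGroup K] [MeasurableSpace K] [BorelSpace K] [CompactSpace K] [SecondCountableTopology K]
  (μK : Measure K) [IsProbabilityMeasure μK] [μK.IsMulLeftInvariant]
  (ι : K →* (quasiSplit (↥(maximalRealSubfield L)) L (IsCMField.complexConj L) 3).Adelic)

omit [μK.IsMulLeftInvariant] in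
/-- **THE CLASS BRIDGE**: for the `K`-type projector of ★ `Schur.charProj` along `ρ = R ∘ ι` on `L²(μ)`, `P_τ f =ᵐ x ↦ ∫ (d_τ·conj χ_τ(k))·f(ι(k)⁻¹•x) dμ_K` — ★ `Schur.charProj_def`,
`Lp.coeFn_smul`, ★ `coeFn_integral_smul_rightRegular_ae_eq` (the `L²`-valued Bochner integral of translates has the pointwise average as representative), `integral_const_mul`.
[cite: BrockerTomDieck1985, III (5.10)] [cite: BorelJacquet1979, §4.6] -/
theorem coeFn_charProj_rightRegular_ae_eq (hι : Continuous ι)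
    {E : Type*} [NormedAddCommGroup E] [InnerProductSpace ℂ E] [FiniteDimensional ℂ E] (τ : ContRepresentation ℂ K E) (hτc : Continuous (τ : K → E →L[ℂ] E))
    (f : (quasiSplit (↥(maximalRealSubfield L)) L (IsCMField.complexConj L) 3).L2 μ) :
    ((Schur.charProj μK τ (((quasiSplit (↥(maximalRealSubfield L)) L (IsCMField.complexConj L) 3).rightRegular μ).restrict ι) f :
        (quasiSplit (↥(maximalRealSubfield L)) L (IsCMField.complexConj L) 3).L2 μ) : (quasiSplit (↥(maximalRealSubfield L)) L (IsCMField.complexConj L) 3).automorphicQuotient → ℂ) =ᵐ[μ]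
      fun x => ∫ k, ((Module.finrank ℂ E : ℂ) * conj (Schur.character τ k)) *
        (f : (quasiSplit (↥(maximalRealSubfield L)) L (IsCMField.complexConj L) 3).automorphicQuotient → ℂ) ((ι k)⁻¹ • x) ∂μK := by
  haveI : SecondCountableTopology (quasiSplit (↥(maximalRealSubfield L)) L (IsCMField.complexConj L) 3).Adelic :=
    secondCountableTopology_cmDatum_Adelic L 3 ((StdForm.antidiagonal 3).over L)
  have hw : Continuous fun k : K => conj (Schur.character τ k) := Complex.continuous_conj.comp (Schur.continuous_character hτc)
  have hbridge := coeFn_integral_smul_rightRegular_ae_eq (quasiSplit (↥(maximalRealSubfield L)) L (IsCMField.complexConj L) 3) μ μK (ι := ι) hι hw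
    (HasCompactSupport.of_compactSpace _) f
  have hdef : Schur.charProj μK τ (((quasiSplit (↥(maximalRealSubfield L)) L (IsCMField.complexConj L) 3).rightRegular μ).restrict ι) f =
      (Module.finrank ℂ E : ℂ) • ∫ k, conj (Schur.character τ k) • ((quasiSplit (↥(maximalRealSubfield L)) L (IsCMField.complexConj L) 3).rightRegular μ) (ι k) f ∂μK := by
    rw [Schur.charProj_def]
    rfl
  rw [hdef]
  filter_upwards [Lp.coeFn_smul (E := ℂ) (Module.finrank ℂ E : ℂ) (∫ k, conj (Schur.character τ k) • ((quasiSplit (↥(maximalRealSubfield L)) L (IsCMField.complexConj L) 3).rightRegular μ) (ι k) f ∂μK),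
    hbridge] with x hx hb
  rw [hx, Pi.smul_apply, hb, smul_eq_mul, ← integral_const_mul]
  exact integral_congr_ae (Eventually.of_forall fun k => by ring)

omit [μK.IsMulLeftInvariant] in
/-- **THE CLASS BRIDGE AT A RESIDUE CLASS**: if `f =ᵐ x ↦ Fp((out x)⁻¹)(3∕2)` for a residue function left-invariant under `A_G·G(F)` (★ `midPoleLetter_apply_quotientSubgroup_mul`), then
`P_τ f =ᵐ x ↦ ∫ (d_τ·conj χ_τ(k))·Fp((out x)⁻¹·ι k)(3∕2) dμ_K` — §2's bridge, ★ `integral_mul_comp_congr_ae` (a.e. transport JOINTLY in `(x, k)`), ★ `quotFun_rightTranslation`.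
[cite: BrockerTomDieck1985, III (5.10)] [cite: MoeglinWaldspurger1995, IV.1.11] -/
theorem coeFn_charProj_ae_eq_midPoleLetter_rightAverage (hι : Continuous ι)
    {E : Type*} [NormedAddCommGroup E] [InnerProductSpace ℂ E] [FiniteDimensional ℂ E] (τ : ContRepresentation ℂ K E) (hτc : Continuous (τ : K → E →L[ℂ] E))
    (Fp : (quasiSplit (↥(maximalRealSubfield L)) L (IsCMField.complexConj L) 3).Adelic → ℂ → ℂ) (z₀ : ℂ)
    (hinv : ∀ γ ∈ (quasiSplit (↥(maximalRealSubfield L)) L (IsCMField.complexConj L) 3).quotientSubgroup, ∀ g : (quasiSplit (↥(maximalRealSubfield L)) L (IsCMField.complexConj L) 3).Adelic,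
      Fp (γ * g) z₀ = Fp g z₀)
    {f : (quasiSplit (↥(maximalRealSubfield L)) L (IsCMField.complexConj L) 3).L2 μ}
    (hae : (f : (quasiSplit (↥(maximalRealSubfield L)) L (IsCMField.complexConj L) 3).automorphicQuotient → ℂ) =ᵐ[μ]
      fun x => Fp (Quotient.out (x : (quasiSplit (↥(maximalRealSubfield L)) L (IsCMField.complexConj L) 3).Adelic ⧸
        (quasiSplit (↥(maximalRealSubfield L)) L (IsCMField.complexConj L) 3).quotientSubgroup))⁻¹ z₀) :
    ((Schur.charProj μK τ (((quasiSplit (↥(maximalRealSubfield L)) L (IsCMField.complexConj L) 3).rightRegular μ).restrict ι) f :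
        (quasiSplit (↥(maximalRealSubfield L)) L (IsCMField.complexConj L) 3).L2 μ) : (quasiSplit (↥(maximalRealSubfield L)) L (IsCMField.complexConj L) 3).automorphicQuotient → ℂ) =ᵐ[μ]
      fun x => ∫ k, ((Module.finrank ℂ E : ℂ) * conj (Schur.character τ k)) *
        Fp ((Quotient.out (x : (quasiSplit (↥(maximalRealSubfield L)) L (IsCMField.complexConj L) 3).Adelic ⧸
          (quasiSplit (↥(maximalRealSubfield L)) L (IsCMField.complexConj L) 3).quotientSubgroup))⁻¹ * ι k) z₀ ∂μK := by
  haveI : SecondCountableTopology (quasiSplit (↥(maximalRealSubfield L)) L (IsCMField.complexConj L) 3).Adelic :=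
    secondCountableTopology_cmDatum_Adelic L 3 ((StdForm.antidiagonal 3).over L)
  have h1 := coeFn_charProj_rightRegular_ae_eq L μ μK ι hι τ hτc f
  have h2 := integral_mul_comp_congr_ae (quasiSplit (↥(maximalRealSubfield L)) L (IsCMField.complexConj L) 3) μ μK (ι := ι) hι.measurable hae
    (fun k : K => (Module.finrank ℂ E : ℂ) * conj (Schur.character τ k))
  refine h1.trans (h2.trans (Eventually.of_forall fun x => integral_congr_ae (Eventually.of_forall fun k => ?_)))
  have h3 := congrFun (AdelicGroupData.quotFun_rightTranslation (φ := fun y : (quasiSplit (↥(maximalRealSubfield L)) L (IsCMField.complexConj L) 3).Adelic => Fp y z₀) hinv (ι k)) x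
  show (Module.finrank ℂ E : ℂ) * conj (Schur.character τ k) * Fp (Quotient.out ((ι k)⁻¹ • x : (quasiSplit (↥(maximalRealSubfield L)) L (IsCMField.complexConj L) 3).Adelic ⧸
      (quasiSplit (↥(maximalRealSubfield L)) L (IsCMField.complexConj L) 3).quotientSubgroup))⁻¹ z₀ = _
  congr 1
  exact h3.symm

end Bridge

/-! ## §3 HEAD: the letter (hKreg) of ★ `hW1_of_regular` -/

section Head

variable (L : Type) [Field L] [NumberField L] [IsCMField L]
  [MeasurableSpace (quasiSplit (↥(maximalRealSubfield L)) L (IsCMField.complexConj L) 3).Adelic] [BorelSpace (quasiSplit (↥(maximalRealSubfield L)) L (IsCMField.complexConj L) 3).Adelic]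
  (μ : Measure (quasiSplit (↥(maximalRealSubfield L)) L (IsCMField.complexConj L) 3).automorphicQuotient)
  [(quasiSplit (↥(maximalRealSubfield L)) L (IsCMField.complexConj L) 3).IsAutomorphicMeasure μ]
  (ξ : OneDimAutRepH L) (μω : HeckeCharacter L)
  [MeasurableSpace ↥(UnitaryGroup.arch (↥(maximalRealSubfield L)) L (IsCMField.complexConj L) 3 ((StdForm.antidiagonal 3).over L) ⊓ unitaryGroupOfForm (conjMixed (↥(maximalRealSubfield L)) L (IsCMField.complexConj L)) 1)]
  [BorelSpace ↥(UnitaryGroup.arch (↥(maximalRealSubfield L)) L (IsCMField.complexConj L) 3 ((StdForm.antidiagonal 3).over L) ⊓ unitaryGroupOfForm (conjMixed (↥(maximalRealSubfield L)) L (IsCMField.complexConj L)) 1)]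
  [SecondCountableTopology ↥(UnitaryGroup.arch (↥(maximalRealSubfield L)) L (IsCMField.complexConj L) 3 ((StdForm.antidiagonal 3).over L) ⊓ unitaryGroupOfForm (conjMixed (↥(maximalRealSubfield L)) L (IsCMField.complexConj L)) 1)]
  (μK : Measure ↥(UnitaryGroup.arch (↥(maximalRealSubfield L)) L (IsCMField.complexConj L) 3 ((StdForm.antidiagonal 3).over L) ⊓ unitaryGroupOfForm (conjMixed (↥(maximalRealSubfield L)) L (IsCMField.complexConj L)) 1))
  [IsProbabilityMeasure μK] [μK.IsMulLeftInvariant]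

/-- **(hKreg) — THE `K_∞`-TYPE CUT OF THE CLASS OF A REGULAR τ-LEVEL DATUM IS A τ-ADMISSIBLE GENERATOR** — the binder `hKreg` of ★ p865108 `hW1_of_regular` BYTE FOR BYTE, from `μω`
unitary alone (D1's sections are then bounded, ★; the structural identity `archMaximalCompact = ι_∞(K_∞)` is §0).  For a τ-level `U₀`, a
REGULAR datum `(φ, Ec, Sp, Fp)` (D1's clauses + T's `hE4`∕`hEbd`) with class `f`, and an irreducible unitary finite-dimensional `τ`: the averaged datum of ★ `admissible_rightAverage` with
weight `c = d_τ·conj χ_τ` along `ι = ι_∞ ∘ incl` (pair law at the τ-level ★ `commute_archToAdelic_finAdelicToAdelic`, height invariance ★ `adelicVal_archToAdelic_inclusion_mem_standardMaximalCompactGL`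
+ ★ `borelHeight_mul_of_mem_comap_standardMaximalCompactGL`, compactness ★ `compactSpace_arch_inf_unitaryOne`) is admissible, `K_∞`-finite (§1), and its pole letter represents `P_τ f`
(§2) — so `Schur.charProj μK τ (R ∘ ι) f ∈ resGMidAtomGenτ ξ μω U₀`. [cite: MoeglinWaldspurger1995, I.2.17, II.1, IV.1.9–IV.1.11, V.3.13] [cite: BrockerTomDieck1985, III Thm (5.10)]
[cite: BorelJacquet1979, §4.1, §4.6] -/
theorem hKreg_of_regular (hμω : μω.IsUnitary) :
    ∀ (U₀ : Subgroup ↥(finAdelic (↥(maximalRealSubfield L)) L (IsCMField.complexConj L) 3 ((StdForm.antidiagonal 3).over L))) (_ : IsTauLevel L U₀)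
      (φ : (quasiSplit (↥(maximalRealSubfield L)) L (IsCMField.complexConj L) 3).Adelic → ℂ)
      (_ : φ ∈ chiSectionSpacePair (ξ.bcη⁻¹ * ξ.bcψ⁻¹ * μω) ξ.ψ (tauLevel L U₀) ((1 : ↥(tauLevel L U₀) →* ℂ) : ↥(tauLevel L U₀) → ℂ)) (_ : Continuous φ)
      (Ec : ℂ → (quasiSplit (↥(maximalRealSubfield L)) L (IsCMField.complexConj L) 3).Adelic → ℂ) (Sp : Finset ℂ)
      (_ : ∀ s ∈ Sp, s.im = 0 ∧ 1 < s.re ∧ s.re ≤ 2)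
      (_ : ∀ g, DifferentiableOn ℂ (fun z => Ec z g) ({z : ℂ | 1 < z.re} \ (↑Sp : Set ℂ)))
      (_ : ∀ z ∈ ({z : ℂ | 1 < z.re} \ (↑Sp : Set ℂ)), Continuous (Ec z))
      (_ : ∀ z₁ ∈ ({z : ℂ | 1 < z.re} \ (↑Sp : Set ℂ)), ∀ S : Set (quasiSplit (↥(maximalRealSubfield L)) L (IsCMField.complexConj L) 3).Adelic, IsCompact S → ∃ V ∈ 𝓝 z₁, ∃ M : ℝ, ∀ z ∈ V, ∀ g ∈ S, ‖Ec z g‖ ≤ M)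
      (_ : ∀ z : ℂ, 2 < z.re → Ec z = eisensteinSeriesU (flatSectionU φ z))
      (Fp : (quasiSplit (↥(maximalRealSubfield L)) L (IsCMField.complexConj L) 3).Adelic → ℂ → ℂ)
      (_ : ∀ g, AnalyticAt ℂ (Fp g) ((3 : ℂ) / 2))
      (_ : ∀ g, Fp g =ᶠ[𝓝[≠] ((3 : ℂ) / 2)] fun z => (z - (3 : ℂ) / 2) * Ec z g)
      (f : (quasiSplit (↥(maximalRealSubfield L)) L (IsCMField.complexConj L) 3).L2 μ)
      (_ : (f : (quasiSplit (↥(maximalRealSubfield L)) L (IsCMField.complexConj L) 3).automorphicQuotient → ℂ) =ᵐ[μ]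
        fun x => Fp (Quotient.out (x : (quasiSplit (↥(maximalRealSubfield L)) L (IsCMField.complexConj L) 3).Adelic ⧸
          (quasiSplit (↥(maximalRealSubfield L)) L (IsCMField.complexConj L) 3).quotientSubgroup))⁻¹ ((3 : ℂ) / 2))
      (E : Type) [NormedAddCommGroup E] [InnerProductSpace ℂ E] [FiniteDimensional ℂ E]
      (τ : ContRepresentation ℂ ↥(UnitaryGroup.arch (↥(maximalRealSubfield L)) L (IsCMField.complexConj L) 3 ((StdForm.antidiagonal 3).over L) ⊓ unitaryGroupOfForm (conjMixed (↥(maximalRealSubfield L)) L (IsCMField.complexConj L)) 1) E)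
      (_ : Continuous (τ : ↥(UnitaryGroup.arch (↥(maximalRealSubfield L)) L (IsCMField.complexConj L) 3 ((StdForm.antidiagonal 3).over L) ⊓ unitaryGroupOfForm (conjMixed (↥(maximalRealSubfield L)) L (IsCMField.complexConj L)) 1) → E →L[ℂ] E))
      (_ : τ.toRepresentation.IsIrreducible)
      (_ : ∀ (g : ↥(UnitaryGroup.arch (↥(maximalRealSubfield L)) L (IsCMField.complexConj L) 3 ((StdForm.antidiagonal 3).over L) ⊓ unitaryGroupOfForm (conjMixed (↥(maximalRealSubfield L)) L (IsCMField.complexConj L)) 1)) (x y : E), ⟪τ g x, τ g y⟫_ℂ = ⟪x, y⟫_ℂ),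
      Schur.charProj μK τ ((((quasiSplit (↥(maximalRealSubfield L)) L (IsCMField.complexConj L) 3).rightRegular μ).restrict
        ((archToAdelic (↥(maximalRealSubfield L)) L (IsCMField.complexConj L) 3 ((StdForm.antidiagonal 3).over L)).comp
          (Subgroup.inclusion (inf_le_left : (UnitaryGroup.arch (↥(maximalRealSubfield L)) L (IsCMField.complexConj L) 3 ((StdForm.antidiagonal 3).over L) ⊓ unitaryGroupOfForm (conjMixed (↥(maximalRealSubfield L)) L (IsCMField.complexConj L)) 1) ≤
            UnitaryGroup.arch (↥(maximalRealSubfield L)) L (IsCMField.complexConj L) 3 ((StdForm.antidiagonal 3).over L)))))) f ∈ resGMidAtomGenτ L μ ξ μω U₀ := by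
  intro U₀ _ φ hφV hφc Ec Sp hSp hol hE4 hEbd hEc2 Fp hFp hFpE f hae E _ _ _ τ hτc _ hτu
  haveI : CompactSpace ↥(UnitaryGroup.arch (↥(maximalRealSubfield L)) L (IsCMField.complexConj L) 3 ((StdForm.antidiagonal 3).over L) ⊓ unitaryGroupOfForm (conjMixed (↥(maximalRealSubfield L)) L (IsCMField.complexConj L)) 1) :=
    compactSpace_arch_inf_unitaryOne L 3 ((StdForm.antidiagonal 3).over L)
  -- the structure letters of the averaging family `(K_∞, μ_K, ι_∞ ∘ incl, d_τ·conj χ_τ)`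
  set ιK := (archToAdelic (↥(maximalRealSubfield L)) L (IsCMField.complexConj L) 3 ((StdForm.antidiagonal 3).over L)).comp
    (Subgroup.inclusion (inf_le_left : (UnitaryGroup.arch (↥(maximalRealSubfield L)) L (IsCMField.complexConj L) 3 ((StdForm.antidiagonal 3).over L) ⊓ unitaryGroupOfForm (conjMixed (↥(maximalRealSubfield L)) L (IsCMField.complexConj L)) 1) ≤
      UnitaryGroup.arch (↥(maximalRealSubfield L)) L (IsCMField.complexConj L) 3 ((StdForm.antidiagonal 3).over L))) with hιK
  have hι : Continuous ιK := (continuous_archToAdelic (↥(maximalRealSubfield L)) L (IsCMField.complexConj L) 3 ((StdForm.antidiagonal 3).over L)).comp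
    (continuous_inclusion_arch_inf_unitaryOne L 3 ((StdForm.antidiagonal 3).over L))
  set c : ↥(UnitaryGroup.arch (↥(maximalRealSubfield L)) L (IsCMField.complexConj L) 3 ((StdForm.antidiagonal 3).over L) ⊓ unitaryGroupOfForm (conjMixed (↥(maximalRealSubfield L)) L (IsCMField.complexConj L)) 1) → ℂ :=
    fun k => (Module.finrank ℂ E : ℂ) * conj (Schur.character τ k) with hc
  have hcc : Continuous c := continuous_const.mul (Complex.continuous_conj.comp (Schur.continuous_character hτc))
  have hH : ∀ (x : (quasiSplit (↥(maximalRealSubfield L)) L (IsCMField.complexConj L) 3).Adelic) (k : ↥(UnitaryGroup.arch (↥(maximalRealSubfield L)) L (IsCMField.complexConj L) 3 ((StdForm.antidiagonal 3).over L) ⊓ unitaryGroupOfForm (conjMixed (↥(maximalRealSubfield L)) L (IsCMField.complexConj L)) 1)),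
      borelHeight (x * ιK k) = borelHeight x := fun x k =>
    borelHeight_mul_of_mem_comap_standardMaximalCompactGL (Subgroup.mem_comap.2 (adelicVal_archToAdelic_inclusion_mem_standardMaximalCompactGL k)) x
  have hcomm : ∀ (k : ↥(UnitaryGroup.arch (↥(maximalRealSubfield L)) L (IsCMField.complexConj L) 3 ((StdForm.antidiagonal 3).over L) ⊓ unitaryGroupOfForm (conjMixed (↥(maximalRealSubfield L)) L (IsCMField.complexConj L)) 1)) (k' : ↥(tauLevel L U₀)),
      ιK k * (k' : (quasiSplit (↥(maximalRealSubfield L)) L (IsCMField.complexConj L) 3).Adelic) = (k' : (quasiSplit (↥(maximalRealSubfield L)) L (IsCMField.complexConj L) 3).Adelic) * ιK k := by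
    intro k k'
    obtain ⟨b, -, hb⟩ := (mem_tauLevel_iff L U₀ (k' : (quasiSplit (↥(maximalRealSubfield L)) L (IsCMField.complexConj L) 3).Adelic)).1 k'.2
    rw [← hb]
    exact (commute_archToAdelic_finAdelicToAdelic _ _ _ _ _ _ b).eq
  -- ★ `admissible_rightAverage`: the averaged datum is admissible
  obtain ⟨hPV, hPc, hPhol, hPE, Fp', hFp', hFp'E, hFp'v⟩ := admissible_rightAverage L μK (fun k => ιK k) c hι hcc hH ξ hμω hcomm hφV hφc Ec Sp hol hE4 hEbd hEc2 Fp hFp hFpE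
  -- `K_∞`-finiteness (§1)
  have hfin : IsArchFinite L (fun x => ∫ k, c k * φ (x * ιK k) ∂μK) :=
    isArchFinite_rightAverage L μK ιK hι c (fun p : Fin (Module.finrank ℂ E) × Fin (Module.finrank ℂ E) => fun k => ⟪τ k (stdOrthonormalBasis ℂ E p.1), stdOrthonormalBasis ℂ E p.2⟫_ℂ)
      (fun p => ((ContinuousLinearMap.apply ℂ E (stdOrthonormalBasis ℂ E p.1)).continuous.comp hτc).inner continuous_const)
      (fun a => exists_matrixCoeff_expansion_conj_character τ hτu _ a) (exists_inclusion_eq_of_mem_archMaximalCompact L) hφc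
  -- the class bridge (§2) at the residue class
  have hinv : ∀ γ ∈ (quasiSplit (↥(maximalRealSubfield L)) L (IsCMField.complexConj L) 3).quotientSubgroup, ∀ g : (quasiSplit (↥(maximalRealSubfield L)) L (IsCMField.complexConj L) 3).Adelic,
      Fp (γ * g) ((3 : ℂ) / 2) = Fp g ((3 : ℂ) / 2) :=
    midPoleLetter_apply_quotientSubgroup_mul L (isChiSectionPair_of_mem hφV) ξ.hψ (fun t ht => (hSp t ht).1) hol hEc2 (by norm_num) (by norm_num) hFp hFpE
  have hcl := coeFn_charProj_ae_eq_midPoleLetter_rightAverage L μ μK ιK hι τ hτc Fp ((3 : ℂ) / 2) hinv hae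
  refine (mem_resGMidAtomGenτ_iff L μ ξ μω U₀ _).2 ⟨_, hPV, hPc, hfin, _, Sp, hSp, hPhol, hPE, Fp', hFp', hFp'E, hcl.trans (Eventually.of_forall fun x => ?_)⟩
  exact (hFp'v _).symm

end Head

end Summit.HodgeConjecture.HodgeConjecture.R90.S8

end
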